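import Literature.Computability.AlgebraicComplexity.GlynnPermanentFormula
import HarnessLib

/-!
# Glynn's formula for the permanent: discharge of `Literature.Computability.AlgebraicComplexity.glynn_permanent_formula`

D-0014 keeps `Literature/` sorry-free by stating cited results as named facts `def X : Prop`.
This sibling file of `Literature.Computability.AlgebraicComplexity.GlynnPermanentFormula`
proves the named fact stated there,

* `Literature.Computability.AlgebraicComplexity.glynn_permanent_formula_holds :
  glynn_permanent_formula`,

i.e. **Glynn's formula** with denominators cleared: for every commutative ring `R`, finite
index type `n` and `A : Matrix n n R`,
`∑_{x ∈ {±1}^n} (∏_k x_k) · ∏_i (∑_j A i j · x_j) = 2^{|n|} · per A`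
(D. G. Glynn 2010; in the expectation form `Per(A) = E_{x ∈ {−1,1}^n}[x_1 ⋯ x_n ∏_i (a_{i,1}
x_1 + ⋯ + a_{i,n} x_n)]` it is Aaronson–Hance 2014, §2, eqs. (2)–(3)). Users of the fact keep
taking `(h : glynn_permanent_formula)` and are now fed `glynn_permanent_formula_holds`.

## The printed proof and the one formalised

Aaronson–Hance 2014, §2, the paragraph after eq. (3) (read on this hub, arXiv:1212.0025 p. 7):
"To see why, we just need to expand the product:
`E_x[Gly_x(A)] = ∑_{σ_1,…,σ_n ∈ [n]} a_{1,σ_1} ⋯ a_{n,σ_n} E_x[(x_1 ⋯ x_n)(x_{σ_1} ⋯ x_{σ_n})]`.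
Then, note that `E_x[(x_1 ⋯ x_n)(x_{σ_1} ⋯ x_{σ_n})]` is `1` if the map `i ↦ σ_i` is a
permutation, and `0` otherwise. Hence the above sum is simply `Per(A)`." We follow it step by
step, multiplied through by `2^n` so that no division occurs and the statement holds over any
commutative ring:

1. `sum_unitsInt_cast_pow_succ`: the one-variable moment `∑_{u = ±1} u^{m+1} = 2 [m odd]`;
2. `sum_units_prod_mul_prod_comp`: for a self-map `f : n → n` (the printed `i ↦ σ_i`),
   `∑_{x ∈ {±1}^n} (∏_k x_k)(∏_i x_{f i}) = ∏_k ∑_{u = ±1} u^{1 + |f⁻¹(k)|}`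
   (`Finset.prod_fiberwise'`, `Fintype.prod_sum`), which is `2^{|n|}` iff every fibre of `f`
   is odd — then every fibre is nonempty, `f` is onto and (finite type) bijective, with all
   fibres singletons — and `0` otherwise;
3. `glynn_permanent_formula_holds`: expand `∏_i ∑_j a_{ij} x_j = ∑_f ∏_i a_{i, f i} x_{f i}`
   (`Fintype.prod_sum`), swap the sums, apply 2., and identify the bijective self-maps with
   `Equiv.Perm n` (`Equiv.ofBijective`); the result is `2^{|n|} ∑_σ ∏_i a_{i, σ i} =
   2^{|n|} per Aᵀ = 2^{|n|} per A` (`Matrix.permanent_transpose`; Mathlib's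
   `Matrix.permanent M = ∑_σ ∏_i M (σ i) i`).

No hypothesis on the characteristic is used. (Glynn 2010 prints the sum halved by the symmetry
`x ↦ −x`, over `{δ ∈ {±1}^n : δ_1 = 1}` with the factor `2^{1-n}`; that normalisation is
the dependent route item's packaging, not part of this fact.)

## References

* [Glynn2010] D. G. Glynn, *The permanent of a square matrix*, European J. Combin. 31 (2010)
  1887–1891, doi:10.1016/j.ejc.2010.01.010 (Glynn's formula; paywalled on this hub,
  acquisition request acq-02540).
* [AaronsonHance2012] S. Aaronson, T. Hance, *Generalizing and derandomizing Gurvits's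
  approximation algorithm for the permanent*, arXiv:1212.0025 = Quantum Inf. Comput. 14
  (2014), doi:10.26421/qic14.7-8-1, §2, eqs. (2)–(3) and the proof paragraph following
  (verbatim secondary statement and proof of Glynn's formula, p. 7 of the arXiv version).
-/

namespace Literature.Computability.AlgebraicComplexity

open scoped BigOperators

/-! ## The three steps of the printed proof

The three steps of the printed argument (Aaronson–Hance 2014, §2, proof after eq. (3);
Glynn 2010): the one-variable moment `∑_{u = ±1} u^{m+1}`, the character-sum
("orthogonality") identity `E_x[(x_1 ⋯ x_n)(x_{f 1} ⋯ x_{f n})] = [f is a permutation]`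
(here multiplied through by `2^n`), and the expansion of the product of row sums. -/

section GlynnProof

variable {R : Type*} [CommRing R] {ι : Type*} [Fintype ι] [DecidableEq ι]

/-- `∑_{u ∈ {±1}} u^{m+1} = 2` if `m` is odd and `= 0` if `m` is even (the one-variable moment
behind "`E[(x_1⋯x_n)(x_{σ_1}⋯x_{σ_n})]` is `1` if `i ↦ σ_i` is a permutation, and `0`
otherwise", Aaronson–Hance 2014, §2). [cite: AaronsonHance2012, §2 eqs. (2)–(3)] -/
theorem sum_unitsInt_cast_pow_succ (m : ℕ) :
    ∑ u : ℤˣ, ((u : ℤ) : R) ^ (m + 1) = if Odd m then (2 : R) else 0 := by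
  rw [show (Finset.univ : Finset ℤˣ) = {1, -1} from UnitsInt.univ, Finset.sum_pair (by decide)]
  rcases Nat.even_or_odd m with hm | hm
  · rw [if_neg (Nat.not_odd_iff_even.2 hm)]
    simp [pow_succ, hm.neg_one_pow]
  · rw [if_pos hm]
    simp only [Units.val_one, Int.cast_one, one_pow, Units.val_neg, Int.cast_neg, pow_succ,
      hm.neg_one_pow]
    ring

/-- **Character sum over `{±1}^ι`** (Aaronson–Hance 2014, §2, the sentence after eq. (3),
cleared of the denominator `2^{|ι|}`): for a self-map `f : ι → ι` of a finite type,
`∑_{x ∈ {±1}^ι} (∏_k x_k) · ∏_i x_{f i} = 2^{|ι|}` if `f` is bijective and `= 0` otherwise.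
Proof as printed: the summand is `∏_k x_k^{1 + |f⁻¹(k)|}`, the sum factors over `k`, each
factor is `2 · [|f⁻¹(k)| odd]`, and all fibres are odd iff (being then nonempty) `f` is onto,
i.e. a permutation of the finite type `ι`. [cite: AaronsonHance2012, §2 eqs. (2)–(3)]
[cite: Glynn2010] -/
theorem sum_units_prod_mul_prod_comp (f : ι → ι) :
    ∑ x : ι → ℤˣ, (∏ k, ((x k : ℤ) : R)) * ∏ i, ((x (f i) : ℤ) : R)
      = if Function.Bijective f then (2 : R) ^ Fintype.card ι else 0 := by
  -- collect the exponent `1 + |f⁻¹(k)|` of each `x_k`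
  have h1 : ∀ x : ι → ℤˣ, (∏ k, ((x k : ℤ) : R)) * ∏ i, ((x (f i) : ℤ) : R)
      = ∏ k, ((x k : ℤ) : R) ^ ((Finset.univ.filter fun i => f i = k).card + 1) := by
    intro x
    have hfib := Finset.prod_fiberwise' (Finset.univ : Finset ι) f (fun k => ((x k : ℤ) : R))
    simp only [Finset.prod_const] at hfib
    rw [← hfib, ← Finset.prod_mul_distrib]
    refine Finset.prod_congr rfl fun k _ => ?_
    rw [pow_succ, mul_comm]
  simp_rw [h1]
  -- the sum over `x` factors over the coordinates `k`
  rw [← Fintype.prod_sum fun k (u : ℤˣ) =>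
    ((u : ℤ) : R) ^ ((Finset.univ.filter fun i => f i = k).card + 1)]
  simp_rw [sum_unitsInt_cast_pow_succ]
  by_cases hf : Function.Bijective f
  · -- every fibre is a singleton
    rw [if_pos hf]
    have hcard : ∀ k, (Finset.univ.filter fun i => f i = k).card = 1 := fun k => by
      rw [Finset.card_eq_one]
      obtain ⟨i, rfl⟩ := hf.2 k
      exact ⟨i, by ext j; simp [hf.1.eq_iff]⟩
    simp [hcard]
  · -- some fibre is even (else all fibres are nonempty and `f` is onto, hence bijective)
    rw [if_neg hf]
    have hk : ∃ k, ¬Odd (Finset.univ.filter fun i => f i = k).card := by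
      by_contra h
      push Not at h
      refine hf (Function.Surjective.bijective_of_finite fun k => ?_)
      have hpos : 0 < (Finset.univ.filter fun i => f i = k).card :=
        Nat.pos_of_ne_zero fun h0 => by have := h k; rw [h0] at this; exact absurd this (by decide)
      obtain ⟨i, hi⟩ := Finset.card_pos.1 hpos
      exact ⟨i, (Finset.mem_filter.1 hi).2⟩
    obtain ⟨k, hk⟩ := hk
    exact Finset.prod_eq_zero (Finset.mem_univ k) (if_neg hk)

end GlynnProof

/-- **Glynn's formula holds** (discharge of the named fact `glynn_permanent_formula`): for every
commutative ring `R`, finite index type `n` and `A : Matrix n n R`,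
`∑_{x ∈ {±1}^n} (∏_k x_k) ∏_i (∑_j A i j x_j) = 2^{|n|} · per A`. Proof as printed in
Aaronson–Hance 2014, §2 (after eq. (3)): expand the product over choice functions
`f : n → n`, swap the sums, kill the non-bijective `f` by the character sum
`sum_units_prod_mul_prod_comp`, and identify the bijective `f` with `Equiv.Perm n`
(`per Aᵀ = per A`, `Matrix.permanent_transpose`). [cite: Glynn2010]
[cite: AaronsonHance2012, §2 eqs. (2)–(3)] -/
theorem glynn_permanent_formula_holds : glynn_permanent_formula := by
  intro n _ _ R _ A
  -- expand the product of the row sums over choice functions `f : n → n`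
  have ha : ∀ x : n → ℤˣ, (∏ i, ∑ j, A i j * ((x j : ℤ) : R))
      = ∑ f : n → n, (∏ i, A i (f i)) * ∏ i, ((x (f i) : ℤ) : R) := by
    intro x
    rw [Fintype.prod_sum]
    simp_rw [Finset.prod_mul_distrib]
  simp_rw [ha, Finset.mul_sum]
  rw [Finset.sum_comm]
  -- for fixed `f`, the signed sum over `x` is `2^{|n|} [f bijective]`
  have hb : ∀ f : n → n, (∑ x : n → ℤˣ,
      (∏ k, ((x k : ℤ) : R)) * ((∏ i, A i (f i)) * ∏ i, ((x (f i) : ℤ) : R)))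
        = (∏ i, A i (f i)) * if Function.Bijective f then (2 : R) ^ Fintype.card n else 0 := by
    intro f
    rw [← sum_units_prod_mul_prod_comp f, Finset.mul_sum]
    refine Finset.sum_congr rfl fun x _ => ?_
    ring
  simp_rw [hb, mul_ite, mul_zero]
  rw [← Finset.sum_filter]
  -- bijective self-maps of the finite type `n` are its permutations: the sum is `2^{|n|} per Aᵀ`
  rw [← Matrix.permanent_transpose, Matrix.permanent, Finset.mul_sum]
  exact Finset.sum_bij
    (fun f hf => Equiv.ofBijective f (Finset.mem_filter.1 hf).2)
    (fun _ _ => Finset.mem_univ _)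
    (fun a₁ _ a₂ _ h => funext fun i => DFunLike.congr_fun h i)
    (fun σ _ => ⟨σ, Finset.mem_filter.2 ⟨Finset.mem_univ _, σ.bijective⟩, Equiv.ext fun _ => rfl⟩)
    (fun f _ => by rw [mul_comm]; simp [Matrix.transpose_apply])

end Literature.Computability.AlgebraicComplexity
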